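import Summits.QuantumFields.BalabanUV.T4Continuum.Spine.NE2.DeltaPrimeHodgeRate
import Summits.QuantumFields.BalabanUV.T4Continuum.Spine.NE2.DictionaryB0

/-!
# T⁴ programme, spine node NE2 (U1a) — THE SECOND-ORDER BLOCK OF (3.10)'s `Δ′` IN THE CATALOGUE AND THE RATE END WITH THE WHOLE `Δ′`
# (repair R13 file 3: residual r1 of the dictionary B0 closed at the catalogue level)

Cell `pub-balaban-gaps` (track G2, seat ne2 = spine estimate NE2; census `run/shared/lean/pub/pub-balaban-gaps/ne/NE2.md` §5 R13, §10).  `Spine/NE2/DeltaPrimeOperator`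
typed (3.10)'s `Δ′ = Σ_x Σ_{μ<ν} (plaqBlock₁ + plaqBlock₂)` with `plaqBlock₁ = curlRowᵀ·symF(cη²(Re U(∂p) − 1))·curlRow` (the second-order block: print's
`tr((D¹A)(p))²·η⁻²(Re U(p) − 1)`, polarised) and `plaqBlock₂` (the commutator block); `Spine/NE2/DeltaPrimeCatalogue` put the commutator block in the catalogue
(`perturbationLaws_deltaPrime₂`) and `Spine/NE2/DeltaPrimeHodgeRate` gave the consistency feed and the rate END with that block.  THIS FILE does the same for the
SECOND-ORDER block and assembles the whole `Δ′`.  The point (print, p. 392: «Δ′ will be a bounded, small operator»): `curlRow = Σ_j edgeM j` is the UNIT-lattice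
curl row — four contractive edge evaluations ((3.4); `DeltaPrimeCatalogue.edgeM_eq_tproj`) — and ALL powers of the lattice spacing sit in the middle factor
`S = symF(cη²(Re U(∂p) − 1))` (small under (3.35): `cη²(Re U − 1) = O(α₀²·L^{−2k})`), so `Σ_x plaqBlock₁ = Σ_{(j,j′)} edgeM_jᵀ·S·edgeM_{j′}` is a sum of SIXTEEN
catalogue terms `siteMul(pairField (edgeR j) S (edgeR j′) δ_j κ_j)·((Π_{κ_jκ_{j′}}·T_{δ_{j′}−δ_j}) ⊗ 1)` per direction pair (`DeltaPrimeCatalogue.sum_pairTerm_eq`), each with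
`PerturbationLaws` by `ComponentSwapShift.perturbationLaws_siteMul_swap_mul` + `DeltaPrimeCatalogue.shiftLaws_edgeTransl` — NO second-order (`‖∇∇𝒢‖`) estimate is needed.
CONTENT.  §1 `Sfield`, **`sum_plaqBlock₁_eq`** (the sixteen-term decomposition, exact); §2 `zS` (field towers), `deltaPrime₁` (the block along the tower),
`deltaPrime₁_eq`, **`perturbationLaws_deltaPrime₁`**, `deltaPrime_eq_add` (`Δ′ = Δ′₁ + Δ′₂` along the tower, by definition), **`perturbationLaws_deltaPrime`** /
`perturbationLaws_deltaPrime'` (the WHOLE `Δ′` has the target shape `PerturbationLaws (Δ_a ⊗ 1) Δ′ (J ⊗ 1) κ (C·L^{−k})` from `BoundedBackgroundM` of the explicit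
plaquette-field towers `zS`, `zF`, `zB`, constants `kappaDP`/`CDP` collapsed finite sums), **`boundedBackgroundM_zS`** (the feed: size + shifted block-parent consistency
of `edgeR j`, `S`, `edgeR j′` ⟹ the hypothesis; with `DeltaPrimeCatalogue.shifted_consistent` this is NE3's two-level consistency + (3.35)/(3.36) lattice-Lipschitz ON
THE DATA); §3 **`balaban_hodge_deltaPrime_rate`**: for a `U(N)` bond-field tower `V` read through `R_b := Ad ∘ V` (`AdjointFieldInstance.adRep`) and every coupling
`t` with `‖t‖·(κ_H + κ_{Δ′}) < 1`,
  `TowerLimitRate (Qlev ⊗ 1) L^d (k ↦ (Δ_a^{(k)} ⊗ 1 + t·(P_B(Ad V) k + hodgeCorr(Ad V) k + Δ′(V k)))⁻¹) (Cpert (κ_H + κ_{Δ′}) (2dCst) CJ (C₂^H + C_{Δ′}) 0 t) L⁻¹`,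
displayed binders = those of `DeltaPrimeHodgeRate.balaban_hodge_deltaPrime₂_rate` plus `BoundedBackgroundM` of the `zS` — NOTHING ELSE; §4 the same END AT
COUPLING ONE written IN PRINT'S VOCABULARY through the dictionary B0 (`hodge_operator_eq_principalB9` ⇐ `DictionaryB0.hodgeTierB_eq_principalB9`, exact):
**`principalB9_deltaPrime_rate_of_regular`** — `TowerLimitRate (Qlev ⊗ 1) L^d (k ↦ (principalB9 (Ad V_k) (P_k) + a·Q*Q ⊗ 1 + avgPert(Ad V) k + Δ′(V_k))⁻¹) (Cpert … 0 1) L⁻¹`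
under `RegularSites (Ad ∘ V) α β β₂`, NE3's `LocalRate` BY NAME, the mixed-shift `ShiftLaws`, `α, β ≤ η ≤ etaStar ι d a a′` (`NE2BalabanThreshold.smallness_of_le`),
`BoundedBackgroundM` of `zS`/`zF`/`zB`, and ONE displayed threshold `κ_H + κ_{Δ′} < 1`: print's (3.26) `Δ_a(U)` at `R = Ad V` with the model's averaging term in
place of [B7]'s `Q*(U)aQ(U)` (residual r2) — the dictionary B0's residual r1 ((3.10)'s `Δ′`) is now typed AND in the catalogue, both blocks, and carried by the END.
HONEST FRAMING (T4-DAG p. 1).  Composition BY NAME at MODEL LEVEL (`V`, `e`, `c` DATA; hypothesis structures displayed; nothing printed is a hypothesis or a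
conclusion); NOT asserted: that `V` is Bałaban's minimiser or that the displayed structures hold for it (node NE3, OPEN), the [B7] averaging (r2), `t = 1`;
NE2 (U1a) NOT PROVED; spine PROVED 0/9 unchanged; NOT continuum YM / infinite volume / mass gap / Clay.  HONEST DEPENDENCY: continuum YM on T⁴ ⇐ BetaPertH ∧ nine
spine estimates (0/9 proved); BetaPertH ⇐ (D1) ∧ (D4) ∧ CAP+tail; G-an2-4 gates asym, D1 and NE2/3/4.  No `sorry`; `def`s are the named objects/constants only.
-/

noncomputable section

open scoped BigOperators ComplexConjugate Matrix



namespace Summit.QuantumFields.BalabanUV.T4Continuum.NE2.DeltaPrimeSecondOrder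

open scoped Kronecker Matrix.Norms.L2Operator
open Literature.MathematicalPhysics.QuantumFieldTheory.Balaban1983to89.B5Prop11Plancherel (Tor fine shiftM unitVec Cst Cst_nonneg)
open Literature.MathematicalPhysics.QuantumFieldTheory.Balaban1983to89.B5G183RateUnitTower (lev lev_neZero)
open Literature.MathematicalPhysics.QuantumFieldTheory.Balaban1983to89.T4EtaRateMin (LocalRate)
open Summit.QuantumFields.BalabanUV.T4Continuum
open Summit.QuantumFields.BalabanUV.T4Continuum.BalabanAveragedTowerUnit (idx Qlev)
open Summit.QuantumFields.BalabanUV.T4Continuum.BalabanAveragedTowerModes (par)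
open Summit.QuantumFields.BalabanUV.T4Continuum.CovariantAveragingTower (TowerLimitRate)
open Summit.QuantumFields.BalabanUV.T4Continuum.BackgroundResolventTower (PerturbationLaws Cpert)
open Summit.QuantumFields.BalabanUV.T4Continuum.KingPairingPlantedLaw (calDalev JpcT CJ)
open Summit.QuantumFields.BalabanUV.T4Continuum.TransportedSiteAveraging (Dc Jc)
open Summit.QuantumFields.BalabanUV.T4Continuum.BlockMultiplication (siteMul)
open Summit.QuantumFields.BalabanUV.T4Continuum.ComponentSwapShift (swapT cSwap perturbationLaws_siteMul_swap_mul)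
open Summit.QuantumFields.BalabanUV.T4Continuum.BalabanBlockPoincare (transl)
open Summit.QuantumFields.BalabanUV.T4Continuum.ColourCovariantLaplacian (BoundedBackgroundM)
open Summit.QuantumFields.BalabanUV.T4Continuum.PerturbationAlgebra (perturbationLaws_add perturbationLaws_mono)
open Summit.QuantumFields.BalabanUV.T4Continuum.KroneckerUnits (perturbationLaws_finsetSum)
open Summit.QuantumFields.BalabanUV.T4Continuum.KroneckerLift (kron_mul)
open Summit.QuantumFields.BalabanUV.T4Continuum.NE2FromNE3 (bgReadings)
open Summit.QuantumFields.BalabanUV.T4Continuum.RegularBackgroundTower (betaNE3)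
open Summit.QuantumFields.BalabanUV.T4Continuum.ShiftedZerothOrder (ShiftLaws)
open Summit.QuantumFields.BalabanUV.T4Continuum.HodgeCorrectionLaws (hodgeCorr)
open Summit.QuantumFields.BalabanUV.T4Continuum.HolonomyTowerRegular (RegularSites regClass₂)
open Summit.QuantumFields.BalabanUV.T4Continuum.GaugeTermPerturbationLaw (deltaK)
open Summit.QuantumFields.BalabanUV.T4Continuum.GaugeTermScalarData (QuT Q1)
open Summit.QuantumFields.BalabanUV.T4Continuum.GaugeTermInstanceGeom (gS)
open Summit.QuantumFields.BalabanUV.T4Continuum.ScalarAveragedCompression (sigma0)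
open Summit.QuantumFields.BalabanUV.T4Continuum.ScalarCovariantLaplacian (kappaS)
open Summit.QuantumFields.BalabanUV.T4Continuum.RegularSiteTransporters (siteT)
open Summit.QuantumFields.BalabanUV.T4Continuum.NestedContourTransport (theta0)
open Summit.QuantumFields.BalabanUV.T4Continuum.CovariantAveragingSummand (kappaQ kappaQ_ofReal)
open Summit.QuantumFields.BalabanUV.T4Continuum.GramPerturbationLaw (C2gram)
open Summit.QuantumFields.BalabanUV.T4Continuum.NE2BalabanRoot (balabanPert)
open Summit.QuantumFields.BalabanUV.T4Continuum.NE2BalabanGauge (gaugeSlot liftR)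
open Summit.QuantumFields.BalabanUV.T4Continuum.NE2BalabanLayerSharp (kappaBs C2Bs)
open Summit.QuantumFields.BalabanUV.T4Continuum.NE2BalabanWiring (epsR CdeltaR)
open Summit.QuantumFields.BalabanUV.T4Continuum.NE2BalabanFinal (tauR kappa4F C4F)
open Summit.QuantumFields.BalabanUV.T4Continuum.NE2BalabanHodge (perturbationLaws_balaban_hodge)
open Summit.QuantumFields.BalabanUV.T4Continuum.NE2ColourPerturbedLayer (towerLimitRate_perturbed_king_kron)
open Summit.QuantumFields.BalabanUV.Beta.AdjointCarrierWiring (adMat)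
open Summit.QuantumFields.BalabanUV.Beta.AdjointCarrierWiringEnd (CompFamily)
open Summit.QuantumFields.BalabanUV.T4Continuum.NE2.AdjointFieldInstance (adRep)
open Summit.QuantumFields.BalabanUV.T4Continuum.NE2.DeltaPrimeOperator
open Summit.QuantumFields.BalabanUV.T4Continuum.NE2.DeltaPrimeCatalogue
open Summit.QuantumFields.BalabanUV.T4Continuum.NE2.DeltaPrimeHodgeRate (kappaDP2 CDP2 perturbationLaws_deltaPrime₂')
open Summit.QuantumFields.BalabanUV.T4Continuum.NE2.DictionaryB0 (principalB9 hodgeTierB_eq_principalB9)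
open Summit.QuantumFields.BalabanUV.T4Continuum.NE2BalabanRoot (avgPert)
open Summit.QuantumFields.BalabanUV.T4Continuum.NE2BalabanLayer (tierBPert)
open Summit.QuantumFields.BalabanUV.T4Continuum.NE2BalabanThreshold (etaStar smallness_of_le)
open Summit.QuantumFields.BalabanUV.T4Continuum.ColourCovariantLaplacian (covPertC)
open Summit.QuantumFields.BalabanUV.T4Continuum.WeitzenbockBridge (slotLift)
open Summit.QuantumFields.BalabanUV.T4Continuum.GaugeTermSandwichBound (projP)
open Summit.QuantumFields.BalabanUV.T4Continuum.GaugeTermLayer (Gop)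
open Literature.MathematicalPhysics.QuantumFieldTheory.Balaban1983to89.B5Block118 (QvOp)
open Literature.MathematicalPhysics.QuantumFieldTheory.Balaban1983to89.B5DeltaA169 (QvAdj)

variable {n : Type} [Fintype n] [DecidableEq n] {d : ℕ} {ι : Type} [Fintype ι] [DecidableEq ι]

/-! ## §1 One level: the second-order block is a sum of sixteen catalogue terms per direction pair -/

section OneLevel

variable (Nf : Fin d → ℕ) [hNf : ∀ μ, NeZero (Nf μ)] (cη : ℝ) (c : ℝ) (e : ι → Matrix n n ℂ)

/-- the plaquette colour matrix of the second-order block: `S(x) = symF(cη²·(Re U(∂p_{μν}(x)) − 1))`. [folklore] -/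
def Sfield (V : Fin d → Tor Nf → Matrix n n ℂ) (μ ν : Fin d) (x : Tor Nf) : Matrix ι ι ℂ :=
  symF c e ((((cη : ℂ)) ^ 2) • (reHol Nf V x μ ν - 1))

/-- **THE SECOND-ORDER BLOCK OF `Δ′` IS A FINITE SUM OF CATALOGUE TERMS**: `Σ_x plaqBlock₁ = Σ_{(j,j′)} siteMul(pairField (edgeR j) S (edgeR j′) δ_j κ_j)·((Π_{κ_j κ_j′}·T_{δ_j′−δ_j}) ⊗ 1)`
over ALL sixteen edge pairs — the unit-lattice curl row is the sum of the four edge evaluations ((3.4), `curlRow = Σ_j edgeM j`), and (3.10)'s first term has the small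
plaquette field `η⁻²(Re U(∂p) − 1)` in the middle, so it is a bounded zeroth-order shape exactly like the commutator block (print: «Δ′ will be a bounded, small operator»).
[cite: Balaban1985BackgroundPropagators, (3.10) p.392 (shape)] [folklore] -/
theorem sum_plaqBlock₁_eq (V : Fin d → Tor Nf → Matrix n n ℂ) (μ ν : Fin d) :
    ∑ x, plaqBlock₁ Nf cη c e V x μ ν
      = ∑ jj : Fin 4 × Fin 4,
          siteMul (pairField Nf (fun x => edgeR Nf c e V x μ ν jj.1) (Sfield Nf cη c e V μ ν) (fun x => edgeR Nf c e V x μ ν jj.2)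
              (edgeOff Nf μ ν jj.1) (edgeSlot μ ν jj.1))
            * (swapT Nf (edgeSlot μ ν jj.1) (edgeSlot μ ν jj.2) * transl Nf (edgeOff Nf μ ν jj.2 - edgeOff Nf μ ν jj.1)) ⊗ₖ (1 : Matrix ι ι ℂ) := by
  have hx : ∀ x, plaqBlock₁ Nf cη c e V x μ ν = ∑ jj : Fin 4 × Fin 4,
      (tproj Nf (edgeR Nf c e V x μ ν jj.1) (x + edgeOff Nf μ ν jj.1, edgeSlot μ ν jj.1))ᵀ * Sfield Nf cη c e V μ ν x
        * tproj Nf (edgeR Nf c e V x μ ν jj.2) (x + edgeOff Nf μ ν jj.2, edgeSlot μ ν jj.2) := by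
    intro x
    rw [plaqBlock₁, curlRow, Matrix.transpose_sum, Matrix.sum_mul, Matrix.sum_mul, Fintype.sum_prod_type]
    refine Finset.sum_congr rfl fun j _ => ?_
    rw [Matrix.mul_sum]
    refine Finset.sum_congr rfl fun j' _ => ?_
    rw [edgeM_eq_tproj, edgeM_eq_tproj]
    rfl
  simp only [hx]
  rw [Finset.sum_comm]
  refine Finset.sum_congr rfl fun jj _ => ?_
  exact sum_pairTerm_eq Nf _ _ _ _ _ _ _

end OneLevel

/-! ## §2 Along the tower: `PerturbationLaws` for the second-order block and for the whole `Δ′` -/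

section Tower

variable (L : ℕ) [NeZero L] (M : Fin d → ℕ) [hM : ∀ μ, NeZero (M μ)] (a : ℝ) (ha : 0 < a) (c : ℝ) (e : ι → Matrix n n ℂ)
variable (V : (k : ℕ) → Fin d → Tor (fine (lev L k) M) → Matrix n n ℂ)

/-- the catalogue field tower of the second-order block for the pair `(j, j′)` at the `(μ, ν)`-plaquettes. [folklore] -/
def zS (μ ν : Fin d) (jj : Fin 4 × Fin 4) (k : ℕ) : idx L M k → Matrix ι ι ℂ :=
  pairField (fine (lev L k) M) (fun x => edgeR (fine (lev L k) M) c e (V k) x μ ν jj.1) (Sfield (fine (lev L k) M) (lev L k) c e (V k) μ ν)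
    (fun x => edgeR (fine (lev L k) M) c e (V k) x μ ν jj.2) (edgeOff (fine (lev L k) M) μ ν jj.1) (edgeSlot μ ν jj.1)

/-- **THE SECOND-ORDER BLOCK OF `Δ′` ALONG THE TOWER**: `Δ′₁^{(k)} = Σ_x Σ_{μ<ν} plaqBlock₁` at spacing `L^{−k}`. [folklore] -/
def deltaPrime₁ (k : ℕ) : Matrix (idx L M k × ι) (idx L M k × ι) ℂ :=
  ∑ x, ∑ q ∈ dirPairs d, plaqBlock₁ (fine (lev L k) M) (lev L k) c e (V k) x q.1 q.2

/-- the block as a sum of catalogue terms (tower form of `sum_plaqBlock₁_eq`). [folklore] -/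
theorem deltaPrime₁_eq (k : ℕ) :
    deltaPrime₁ L M c e V k = ∑ q ∈ dirPairs d, ∑ jj : Fin 4 × Fin 4,
      siteMul (zS L M c e V q.1 q.2 jj k)
        * (cSwap L M (o := ι) (edgeSlot q.1 q.2 jj.1) (edgeSlot q.1 q.2 jj.2) k
          * transl (fine (lev L k) M) (edgeOff (fine (lev L k) M) q.1 q.2 jj.2 - edgeOff (fine (lev L k) M) q.1 q.2 jj.1) ⊗ₖ (1 : Matrix ι ι ℂ)) := by
  rw [deltaPrime₁, Finset.sum_comm]
  refine Finset.sum_congr rfl fun q _ => ?_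
  rw [sum_plaqBlock₁_eq]
  refine Finset.sum_congr rfl fun jj _ => ?_
  simp only [zS, cSwap, kron_mul]

/-- **`PerturbationLaws` FOR THE SECOND-ORDER BLOCK**: `BoundedBackgroundM` of every `zS` (size `α`, block-parent consistency `β/L^k`) ⟹ the target shape with the explicit
finite-sum constants. [folklore] -/
theorem perturbationLaws_deltaPrime₁ {α β : ℝ} (hS : ∀ μ ν jj, BoundedBackgroundM L M (zS L M c e V μ ν jj) α β) :
    PerturbationLaws (fun k => calDalev L M a ha k ⊗ₖ (1 : Matrix ι ι ℂ)) (deltaPrime₁ L M c e V) (fun k => JpcT L M k ⊗ₖ (1 : Matrix ι ι ℂ))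
      (((dirPairs d).card : ℝ) * ((Fintype.card (Fin 4 × Fin 4) : ℝ) * (α * Cst d a)))
      (fun k => ((dirPairs d).card : ℝ) * ((Fintype.card (Fin 4 × Fin 4) : ℝ) * (Cst d a * (α * (2 * Cst d a) + β * Cst d a))) * ((L : ℝ)⁻¹) ^ k) := by
  have h : PerturbationLaws (Dc L M a ha) (fun k => ∑ q ∈ dirPairs d, ∑ jj : Fin 4 × Fin 4,
      siteMul (zS L M c e V q.1 q.2 jj k)
        * (cSwap L M (o := ι) (edgeSlot q.1 q.2 jj.1) (edgeSlot q.1 q.2 jj.2) k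
          * transl (fine (lev L k) M) (edgeOff (fine (lev L k) M) q.1 q.2 jj.2 - edgeOff (fine (lev L k) M) q.1 q.2 jj.1) ⊗ₖ (1 : Matrix ι ι ℂ))) (Jc L M) _ _ :=
    perturbationLaws_finsetSum _ fun q _ => perturbationLaws_finsetSum _ fun jj _ =>
      perturbationLaws_siteMul_swap_mul L M a ha (hS q.1 q.2 jj) _ _ (shiftLaws_edgeTransl L M a ha q.1 q.2 jj.1 jj.2)
  have hfun : deltaPrime₁ L M c e V = fun k => ∑ q ∈ dirPairs d, ∑ jj : Fin 4 × Fin 4,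
      siteMul (zS L M c e V q.1 q.2 jj k)
        * (cSwap L M (o := ι) (edgeSlot q.1 q.2 jj.1) (edgeSlot q.1 q.2 jj.2) k
          * transl (fine (lev L k) M) (edgeOff (fine (lev L k) M) q.1 q.2 jj.2 - edgeOff (fine (lev L k) M) q.1 q.2 jj.1) ⊗ₖ (1 : Matrix ι ι ℂ)) :=
    funext fun k => deltaPrime₁_eq L M c e V k
  rw [hfun]
  refine perturbationLaws_mono h (le_of_eq ?_) fun k => le_of_eq ?_
  · simp only [Finset.sum_const, Finset.card_univ, nsmul_eq_mul]
  · simp only [Finset.sum_const, Finset.card_univ, nsmul_eq_mul]; ring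

/-- **`Δ′` ALONG THE TOWER IS THE SUM OF ITS TWO BLOCKS**: `deltaPrime (L^k) (V k) = Δ′₁^{(k)} + Δ′₂^{(k)}`. [folklore] -/
theorem deltaPrime_eq_add (k : ℕ) :
    deltaPrime (fine (lev L k) M) (lev L k) c e (V k) = deltaPrime₁ L M c e V k + deltaPrime₂ L M c e V k := by
  rw [deltaPrime, deltaPrime₁, deltaPrime₂, ← Finset.sum_add_distrib]
  refine Finset.sum_congr rfl fun x _ => ?_
  rw [← Finset.sum_add_distrib]

/-- **`PerturbationLaws` FOR THE WHOLE `Δ′`** from the catalogue-field hypotheses of both blocks. [folklore] -/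
theorem perturbationLaws_deltaPrime {α β αz βz : ℝ} (hS : ∀ μ ν jj, BoundedBackgroundM L M (zS L M c e V μ ν jj) α β)
    (hF : ∀ μ ν jj, BoundedBackgroundM L M (zF L M c e V μ ν jj) αz βz) (hB : ∀ μ ν jj, BoundedBackgroundM L M (zB L M c e V μ ν jj) αz βz) :
    PerturbationLaws (fun k => calDalev L M a ha k ⊗ₖ (1 : Matrix ι ι ℂ)) (fun k => deltaPrime (fine (lev L k) M) (lev L k) c e (V k))
      (fun k => JpcT L M k ⊗ₖ (1 : Matrix ι ι ℂ))
      (((dirPairs d).card : ℝ) * ((Fintype.card (Fin 4 × Fin 4) : ℝ) * (α * Cst d a)) + kappaDP2 d a αz)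
      (fun k => ((dirPairs d).card : ℝ) * ((Fintype.card (Fin 4 × Fin 4) : ℝ) * (Cst d a * (α * (2 * Cst d a) + β * Cst d a))) * ((L : ℝ)⁻¹) ^ k
        + CDP2 d a αz βz * ((L : ℝ)⁻¹) ^ k) := by
  have h := perturbationLaws_add (perturbationLaws_deltaPrime₁ L M a ha c e V hS) (perturbationLaws_deltaPrime₂' L M a ha c e V hF hB)
  have hfun : (fun k => deltaPrime (fine (lev L k) M) (lev L k) c e (V k)) = fun k => deltaPrime₁ L M c e V k + deltaPrime₂ L M c e V k :=
    funext fun k => deltaPrime_eq_add L M c e V k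
  rw [hfun]
  exact h

/-- the collapsed `κ`-constant of the whole `Δ′` (second-order block + commutator block). [folklore] -/
def kappaDP (d : ℕ) (a α αz : ℝ) : ℝ :=
  ((dirPairs d).card : ℝ) * ((Fintype.card (Fin 4 × Fin 4) : ℝ) * (α * Cst d a)) + kappaDP2 d a αz

/-- the collapsed consistency constant of the whole `Δ′`. [folklore] -/
def CDP (d : ℕ) (a α β αz βz : ℝ) : ℝ :=
  ((dirPairs d).card : ℝ) * ((Fintype.card (Fin 4 × Fin 4) : ℝ) * (Cst d a * (α * (2 * Cst d a) + β * Cst d a))) + CDP2 d a αz βz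

/-- `perturbationLaws_deltaPrime` with the collapsed constants. [folklore] -/
theorem perturbationLaws_deltaPrime' {α β αz βz : ℝ} (hS : ∀ μ ν jj, BoundedBackgroundM L M (zS L M c e V μ ν jj) α β)
    (hF : ∀ μ ν jj, BoundedBackgroundM L M (zF L M c e V μ ν jj) αz βz) (hB : ∀ μ ν jj, BoundedBackgroundM L M (zB L M c e V μ ν jj) αz βz) :
    PerturbationLaws (fun k => calDalev L M a ha k ⊗ₖ (1 : Matrix ι ι ℂ)) (fun k => deltaPrime (fine (lev L k) M) (lev L k) c e (V k))
      (fun k => JpcT L M k ⊗ₖ (1 : Matrix ι ι ℂ)) (kappaDP d a α αz) (fun k => CDP d a α β αz βz * ((L : ℝ)⁻¹) ^ k) :=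
  perturbationLaws_mono (perturbationLaws_deltaPrime L M a ha c e V hS hF hB) le_rfl fun k => le_of_eq (by rw [CDP]; ring)

omit hM in
/-- **THE FEED FOR THE SECOND-ORDER FIELDS `zS`**: size and shifted block-parent consistency of the three factor towers (`edgeR j`, the plaquette field
`S = symF(cη²(Re U(∂p) − 1))`, `edgeR j′`) ⟹ `BoundedBackgroundM` of `zS` — definitional specialisation of `boundedBackgroundM_pairField`. [folklore] -/
theorem boundedBackgroundM_zS (μ ν : Fin d) (jj : Fin 4 × Fin 4) {b ρl ρr σ : ℝ} (hb : 0 ≤ b) (hρl : 0 ≤ ρl) (hρr : 0 ≤ ρr) (hσ : 0 ≤ σ)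
    (hl : ∀ k x, ‖(edgeR (fine (lev L k) M) c e (V k) x μ ν jj.1)ᵀ‖ ≤ 1) (hr : ∀ k x, ‖edgeR (fine (lev L k) M) c e (V k) x μ ν jj.2‖ ≤ 1)
    (hSb : ∀ k x, ‖Sfield (fine (lev L k) M) (lev L k) c e (V k) μ ν x‖ ≤ b)
    (hlc : ∀ k (y : Tor (fine (lev L (k + 1)) M)),
      ‖(edgeR (fine (lev L (k + 1)) M) c e (V (k + 1)) (y - edgeOff (fine (lev L (k + 1)) M) μ ν jj.1) μ ν jj.1)ᵀ
        - (edgeR (fine (lev L k) M) c e (V k) (par (lev L k) L M y - edgeOff (fine (lev L k) M) μ ν jj.1) μ ν jj.1)ᵀ‖ ≤ ρl / (lev L k : ℕ))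
    (hSc : ∀ k (y : Tor (fine (lev L (k + 1)) M)),
      ‖Sfield (fine (lev L (k + 1)) M) (lev L (k + 1)) c e (V (k + 1)) μ ν (y - edgeOff (fine (lev L (k + 1)) M) μ ν jj.1)
        - Sfield (fine (lev L k) M) (lev L k) c e (V k) μ ν (par (lev L k) L M y - edgeOff (fine (lev L k) M) μ ν jj.1)‖ ≤ σ / (lev L k : ℕ))
    (hrc : ∀ k (y : Tor (fine (lev L (k + 1)) M)),
      ‖edgeR (fine (lev L (k + 1)) M) c e (V (k + 1)) (y - edgeOff (fine (lev L (k + 1)) M) μ ν jj.1) μ ν jj.2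
        - edgeR (fine (lev L k) M) c e (V k) (par (lev L k) L M y - edgeOff (fine (lev L k) M) μ ν jj.1) μ ν jj.2‖ ≤ ρr / (lev L k : ℕ)) :
    BoundedBackgroundM L M (zS L M c e V μ ν jj) b (b * ρl + σ + b * ρr) :=
  boundedBackgroundM_pairField L M (fun k => edgeOff (fine (lev L k) M) μ ν jj.1) (edgeSlot μ ν jj.1) hb hρl hρr hσ hl hr hSb hlc hSc hrc

end Tower

/-! ## §3 The rate END: Hodge-form ROOT B + the whole `Δ′` of (3.10) at `R_b := Ad ∘ V` -/

section Rate

variable (L : ℕ) [NeZero L] (M : Fin d → ℕ) [hM : ∀ μ, NeZero (M μ)] (a : ℝ) (ha : 0 < a) {c : ℝ} {e : ι → Matrix n n ℂ}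

/-- **RATE END WITH THE WHOLE `Δ′`.** For a `U(N)` lattice gauge-field tower `V` read through `R_b := Ad ∘ V` (`adRep`): Bałaban's Hodge-form
background operator (ROOT B's `balabanPert` in the gauge slot + the Hodge correction `[D_b, D_b^*]`) PLUS (3.10)'s bounded operator `Δ′` (both blocks,
`deltaPrime` at spacing `L^{−k}` on the colour fibre `ι ≅ 𝔤` through the frame `e`), scaled by `t`, has `TowerLimitRate` with rate `L⁻¹` under the displayed
binders: regular sites + NE3-type `LocalRate` of the readings (ROOT B), the mixed-shift `ShiftLaws`, `BoundedBackgroundM` of the explicit plaquette-field towers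
`zS` (second-order block) and `zF`/`zB` (commutator block) — reducible to size + consistency + lattice-Lipschitz OF THE DATA by `boundedBackgroundM_zS/zF/zB` and
`DeltaPrimeCatalogue.shifted_consistent` — and ONE smallness threshold on `‖t‖`. Model level; it does NOT assert that `V` is Bałaban's minimiser (NE3) nor the
η-rate NE2 of the print. [cite: Balaban1985BackgroundPropagators, (3.10) p.392, (3.26) p.395, (3.35)–(3.36) p.397 (shapes)] [folklore] -/
theorem balaban_hodge_deltaPrime_rate {Pc : Submodule ℝ (Matrix n n ℂ)} (hF : CompFamily c Pc e) (hL : 2 ≤ L) (hd : 1 ≤ d)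
    (V : (k : ℕ) → Fin d → Tor (fine (lev L k) M) → Matrix.unitaryGroup n ℂ)
    {α β β₂ : ℝ} (hreg₂ : RegularSites L M (fun k ν x => adRep hF (V k ν x)) α β β₂) {C : ℝ} (hC : 0 ≤ C)
    (hNE3₂ : LocalRate (bgReadings L M (regClass₂ L M (fun k ν x => adRep hF (V k ν x)))) C ((L : ℝ)⁻¹)) {a' : ℝ} (ha' : 0 < a')
    (hκ : kappaS d a' α β (tauR d α) < 1)
    (hsmall : ((sigma0 d a') ^ 2)⁻¹ * deltaK (gS d a' (kappaS d a' α β (tauR d α))) (1 + tauR d α) (d * α) (tauR d α) a' < 1)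
    {cm : ℝ} (hS : ∀ μ ν, ShiftLaws L M a ha (fun k => ((shiftM (fine (lev L k) M) μ)ᴴ * shiftM (fine (lev L k) M) ν) ⊗ₖ (1 : Matrix ι ι ℂ)) cm)
    {αs βs αz βz : ℝ} (hSz : ∀ μ ν jj, BoundedBackgroundM L M (zS L M c e (fun k ν x => (V k ν x : Matrix n n ℂ)) μ ν jj) αs βs)
    (hFz : ∀ μ ν jj, BoundedBackgroundM L M (zF L M c e (fun k ν x => (V k ν x : Matrix n n ℂ)) μ ν jj) αz βz)
    (hBz : ∀ μ ν jj, BoundedBackgroundM L M (zB L M c e (fun k ν x => (V k ν x : Matrix n n ℂ)) μ ν jj) αz βz)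
    {t : ℂ} (ht : ‖t‖ * ((kappaBs ι d a α β (a * (epsR ι d α * (2 + epsR ι d α) * Cst d a)) (kappa4F d a a' α β)
      + (d : ℝ) ^ 2 * ((2 * β + 2 * α ^ 2) * Cst d a)) + kappaDP d a αs αz) < 1) :
    TowerLimitRate (fun k => Qlev L M k ⊗ₖ (1 : Matrix ι ι ℂ)) ((L : ℝ) ^ d)
      (fun k => (calDalev L M a ha k ⊗ₖ (1 : Matrix ι ι ℂ)
        + t • (balabanPert L M a (liftR L M (fun k ν x => adRep hF (V k ν x)))
              (gaugeSlot L M (fun k ν x => adRep hF (V k ν x))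
                (QuT L M ι (siteT L M (fun k ν x => adRep hF (V k ν x)))) (Q1 L M ι) a') k
            + hodgeCorr L M (fun k ν x => adRep hF (V k ν x)) k
            + deltaPrime (fine (lev L k) M) (lev L k) c e (fun ν x => (V k ν x : Matrix n n ℂ))))⁻¹)
      (Cpert ((kappaBs ι d a α β (a * (epsR ι d α * (2 + epsR ι d α) * Cst d a)) (kappa4F d a a' α β)
          + (d : ℝ) ^ 2 * ((2 * β + 2 * α ^ 2) * Cst d a)) + kappaDP d a αs αz) (2 * d * Cst d a) (CJ d a)
        ((C2Bs ι d L a α β (betaNE3 ι C + β₂)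
            (a * C2gram (Cst d a) 1 (epsR ι d α) (2 * d * Cst d a) (CJ d a) (Cst d a)
              (CdeltaR ι d a α (theta0 d α (betaNE3 ι (betaNE3 ι C + β₂)))))
            (C4F ι d L a a' α β (betaNE3 ι C + β₂))
          + (d : ℝ) ^ 2 * (Cst d a * ((2 * β + 2 * α ^ 2) * cm + (2 * (betaNE3 ι C + β₂) + 4 * α * (betaNE3 ι C + β)) * Cst d a)))
          + CDP d a αs βs αz βz)
        0 t) ((L : ℝ)⁻¹) := by
  have hlaw := perturbationLaws_balaban_hodge L M a ha hd hreg₂ hC hNE3₂ ha' hκ hsmall hS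
  rw [kappaQ_ofReal ha.le] at hlaw
  have hΔ := perturbationLaws_deltaPrime' L M a ha c e (fun k ν x => (V k ν x : Matrix n n ℂ)) hSz hFz hBz
  have hsum := perturbationLaws_add hlaw hΔ
  exact towerLimitRate_perturbed_king_kron L M a ha hL (perturbationLaws_mono hsum le_rfl fun k => le_of_eq (by ring)) ht

end Rate

/-! ## §4 The same END at coupling `t = 1`, written with print's (3.26) principal part (dictionary B0) -/

section PrincipalForm

variable (L : ℕ) [NeZero L] (M : Fin d → ℕ) [hM : ∀ μ, NeZero (M μ)] (a : ℝ) (ha : 0 < a) {c : ℝ} {e : ι → Matrix n n ℂ}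

/-- **THE OPERATOR IDENTITY** (dictionary B0, `DictionaryB0.hodgeTierB_eq_principalB9`, plus definitional unfolding of `balabanPert`/`tierBPert`/`gaugeSlot`):
at coupling `1`, ROOT B's Hodge-form operator plus any `X` equals print's (3.26) PRINCIPAL PART `principalB9 (R_k) (P_k)` + the free averaging term
`a·Q*Q ⊗ 1` + the model's averaging perturbation `avgPert` + `X`. Exact; no estimate. [cite: Balaban1985BackgroundPropagators, (3.26) p.395 (shape)] [folklore] -/
theorem hodge_operator_eq_principalB9 (Rb : (k : ℕ) → Fin d → Tor (fine (lev L k) M) → Matrix ι ι ℂ) {a' : ℝ} (ha' : 0 < a') (k : ℕ)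
    (X : Matrix (idx L M k × ι) (idx L M k × ι) ℂ) :
    calDalev L M a ha k ⊗ₖ (1 : Matrix ι ι ℂ)
        + (1 : ℂ) • (balabanPert L M a (liftR L M Rb) (gaugeSlot L M Rb (QuT L M ι (siteT L M Rb)) (Q1 L M ι) a') k + hodgeCorr L M Rb k + X)
      = principalB9 (fine (lev L k) M) ((lev L k : ℕ) : ℂ) (Rb k)
          (projP (fine (lev L k) M) (Gop L M Rb (QuT L M ι (siteT L M Rb)) a' k) (QuT L M ι (siteT L M Rb) k))
        + ((a : ℂ) • (QvAdj (lev L k) M * QvOp (lev L k) M)) ⊗ₖ (1 : Matrix ι ι ℂ) + avgPert L M a (liftR L M Rb) k + X := by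
  have hl : covPertC L M (liftR L M Rb) k = covPertC L M (fun k => slotLift (fine (lev L k) M) (Rb k)) k := rfl
  rw [one_smul, ← hodgeTierB_eq_principalB9 L M a ha Rb (siteT L M Rb) ha' k, balabanPert, tierBPert, gaugeSlot, hl]
  abel

/-- **RATE END AT COUPLING ONE, IN PRINT'S VOCABULARY.** Under the binders of `balaban_hodge_deltaPrime_rate` with the B4/B5 smallness packaged as
`α, β ≤ η ≤ etaStar ι d a a′` (`NE2BalabanThreshold.smallness_of_le`) and ONE displayed threshold `κ_H + κ_{Δ′} < 1`, the lifted King-averaged covariances of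
`(principalB9 (Ad V_k) (P_k) + a·Q*Q ⊗ 1 + avgPert(Ad V) k + Δ′(V_k))⁻¹` — print's (3.26) `Δ_a(U)` at `R = Ad V` with the model's averaging term in place of [B7]'s
`Q*(U)aQ(U)` (residual r2) — CONVERGE along the tower with rate `L^{−k}`.  Model level; NE3 (that Bałaban's minimiser satisfies the displayed structures) OPEN;
NE2 (U1a) NOT proved by this. [cite: Balaban1985BackgroundPropagators, (3.10) p.392, (3.26) p.395 (shapes)] [folklore] -/
theorem principalB9_deltaPrime_rate_of_regular {Pc : Submodule ℝ (Matrix n n ℂ)} (hF : CompFamily c Pc e) (hL : 2 ≤ L) (hd : 1 ≤ d)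
    (V : (k : ℕ) → Fin d → Tor (fine (lev L k) M) → Matrix.unitaryGroup n ℂ)
    {α β β₂ : ℝ} (hreg₂ : RegularSites L M (fun k ν x => adRep hF (V k ν x)) α β β₂) {C : ℝ} (hC : 0 ≤ C)
    (hNE3₂ : LocalRate (bgReadings L M (regClass₂ L M (fun k ν x => adRep hF (V k ν x)))) C ((L : ℝ)⁻¹)) {a' : ℝ} (ha' : 0 < a')
    {cm : ℝ} (hS : ∀ μ ν, ShiftLaws L M a ha (fun k => ((shiftM (fine (lev L k) M) μ)ᴴ * shiftM (fine (lev L k) M) ν) ⊗ₖ (1 : Matrix ι ι ℂ)) cm)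
    {η : ℝ} (hαη : α ≤ η) (hβη : β ≤ η) (hη : η ≤ etaStar ι d a a')
    {αs βs αz βz : ℝ} (hSz : ∀ μ ν jj, BoundedBackgroundM L M (zS L M c e (fun k ν x => (V k ν x : Matrix n n ℂ)) μ ν jj) αs βs)
    (hFz : ∀ μ ν jj, BoundedBackgroundM L M (zF L M c e (fun k ν x => (V k ν x : Matrix n n ℂ)) μ ν jj) αz βz)
    (hBz : ∀ μ ν jj, BoundedBackgroundM L M (zB L M c e (fun k ν x => (V k ν x : Matrix n n ℂ)) μ ν jj) αz βz)
    (hthr : (kappaBs ι d a α β (a * (epsR ι d α * (2 + epsR ι d α) * Cst d a)) (kappa4F d a a' α β)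
      + (d : ℝ) ^ 2 * ((2 * β + 2 * α ^ 2) * Cst d a)) + kappaDP d a αs αz < 1) :
    TowerLimitRate (fun k => Qlev L M k ⊗ₖ (1 : Matrix ι ι ℂ)) ((L : ℝ) ^ d)
      (fun k => (principalB9 (fine (lev L k) M) ((lev L k : ℕ) : ℂ) (fun ν x => adRep hF (V k ν x))
          (projP (fine (lev L k) M) (Gop L M (fun k ν x => adRep hF (V k ν x)) (QuT L M ι (siteT L M (fun k ν x => adRep hF (V k ν x)))) a' k)
            (QuT L M ι (siteT L M (fun k ν x => adRep hF (V k ν x))) k))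
        + ((a : ℂ) • (QvAdj (lev L k) M * QvOp (lev L k) M)) ⊗ₖ (1 : Matrix ι ι ℂ)
        + avgPert L M a (liftR L M (fun k ν x => adRep hF (V k ν x))) k
        + deltaPrime (fine (lev L k) M) (lev L k) c e (fun ν x => (V k ν x : Matrix n n ℂ)))⁻¹)
      (Cpert ((kappaBs ι d a α β (a * (epsR ι d α * (2 + epsR ι d α) * Cst d a)) (kappa4F d a a' α β)
          + (d : ℝ) ^ 2 * ((2 * β + 2 * α ^ 2) * Cst d a)) + kappaDP d a αs αz) (2 * d * Cst d a) (CJ d a)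
        ((C2Bs ι d L a α β (betaNE3 ι C + β₂)
            (a * C2gram (Cst d a) 1 (epsR ι d α) (2 * d * Cst d a) (CJ d a) (Cst d a)
              (CdeltaR ι d a α (theta0 d α (betaNE3 ι (betaNE3 ι C + β₂)))))
            (C4F ι d L a a' α β (betaNE3 ι C + β₂))
          + (d : ℝ) ^ 2 * (Cst d a * ((2 * β + 2 * α ^ 2) * cm + (2 * (betaNE3 ι C + β₂) + 4 * α * (betaNE3 ι C + β)) * Cst d a)))
          + CDP d a αs βs αz βz)
        0 1) ((L : ℝ)⁻¹) := by
  have hα := hreg₂.nonneg.1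
  have hβ := hreg₂.nonneg.2.1
  obtain ⟨h1, h2, -, -, -, -, -, -⟩ := smallness_of_le (o := ι) (d := d) a ha.le ha' hα hβ hαη hβη hη
  have ht : ‖(1 : ℂ)‖ * ((kappaBs ι d a α β (a * (epsR ι d α * (2 + epsR ι d α) * Cst d a)) (kappa4F d a a' α β)
      + (d : ℝ) ^ 2 * ((2 * β + 2 * α ^ 2) * Cst d a)) + kappaDP d a αs αz) < 1 := by rwa [norm_one, one_mul]
  have hR := balaban_hodge_deltaPrime_rate L M a ha hF hL hd V hreg₂ hC hNE3₂ ha' h1 h2 hS hSz hFz hBz ht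
  convert hR using 3 with k
  rw [hodge_operator_eq_principalB9 L M a ha _ ha']

end PrincipalForm

end Summit.QuantumFields.BalabanUV.T4Continuum.NE2.DeltaPrimeSecondOrder


end
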